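import Mathlib
import HarnessLib
import HarnessLib.Audit
import Summits.AtomisticToContinuum.Statement
import Literature.MathematicalPhysics.KineticTheory.HardSphereEulerProofs
import HarnessLib.Audit.Status.Attr

/-!
Route: KickedOrbits

DORMANT since 2026-08-23T08:16:24Z (reconciler: no traction for 6 d (last activity statement-grounded at 2026-08-17T07:35:55Z); parked, not closed — `ledger route dormant route-AtomisticToContinuum-KickedOrbits --off` to reactivate) — unstaffed, not closed; items shared with open routes are served there. `ledger route dormant <id> --off` reactivates.

# Route KickedOrbits — hydrodynamics with N^(-1/3+) of probability — quenched positions, thermal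
velocities once (or a vanishing kick), deterministic orbits follow pre-shock Euler

It suffices to show X = QuenchedThermalHydro (QUENCHED THERMAL HYDRODYNAMICS): there is a packing
band η₁ > 0 such that for
every σ > 0, every classical hard-sphere Euler solution (ρ,u,θ) on [0,T) with ρσ³ ≤ η₁, every family
of hard-sphere flows and
EVERY sequence of position configurations q_N (N+1 sphere centres on 𝕋³) whose empirical density
converges to ρ(0,·) and whose
Maxwellian fibre is a.e. good, the deterministic orbit started from (q_N, V), V ~ ⊗ᵢ M(u(0,qᵢ),
θ(0,qᵢ)) drawn ONCE at time 0,
has empirical density / momentum / energy fields converging in V-probability to (ρ, ρu, E)(t) for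
all 0 < t < T. Positions
arbitrary, velocities thermal once, dynamics deterministic; no activity profile, no local Gibbs law
and no σ₀ in X — the packing
guard and ∫ρ(0) = 1 (forced by density typicality) carry all smallness. This is the conforming
(D-0027) successor of the retired
route KickedTypicalMicrostate realising card hydrodynamics-without-probability-pre-shock in the form
that survives its audit:
the every-typical-microstate claim DHL is repaired by the least randomness that defeats
chaos-steering — a Maxwellian velocity
kick of size η_N with η_N (N+1)^(1/3) → ∞ (crux KickedMicrostateHydro; η ≡ 1 is X) — and its
Loschmidt content becomes the
typed pre-shock prediction KickedAntiHistory, consistent by the provable support EulerReversal.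
Glue: QuenchedToAnnealed (X ⇒
the packing-guarded conjunct, which IS the re-typed Statement since p126922; soft measure theory
over the proved disintegration
and LLN; an unproved binder of `closes`, hence crux by role at rank 9).
Lean: `∃ η₁ : ℝ, 0 < η₁ ∧ ∀ σ : ℝ, 0 < σ → ∀ (T : ℝ) (ρ θ : ℝ →
Literature.MathematicalPhysics.KineticTheory.T3 → ℝ) (u : ℝ →
Literature.MathematicalPhysics.KineticTheory.T3 → Literature.MathematicalPhysics.KineticTheory.V3),
Literature.MathematicalPhysics.KineticTheory.IsHardSphereEulerSolution σ T ρ u θ → (∀ t ∈ Set.Ico 0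
T, ∀ x, ρ t x * σ ^ 3 ≤ η₁) → ∀ Φ : (N : ℕ) → Literature.Analysis.FluidPDE.HardSphereFlow
(Literature.Analysis.FluidPDE.Torus.geometry (Fin 3))
(Literature.MathematicalPhysics.KineticTheory.hsDiameter σ N) (N + 1), ∀ q : (N : ℕ) → (Fin (N + 1)
→ Literature.MathematicalPhysics.KineticTheory.T3), (∀ N, ∀ᵐ v
∂(Literature.MathematicalPhysics.KineticTheory.velMeasure (u 0) (θ 0) (q N)),
Literature.MathematicalPhysics.KineticTheory.zipConfig (q N, v) ∈ (Φ N).good) → (∀ χ :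
Literature.MathematicalPhysics.KineticTheory.T3 → ℝ, Continuous χ → Filter.Tendsto (fun N : ℕ => ((N
+ 1 : ℕ) : ℝ)⁻¹ * ∑ i, χ (q N i)) Filter.atTop (nhds (∫ x, χ x * ρ 0 x))) → ∀ t ∈ Set.Ioo 0 T,
Literature.MathematicalPhysics.KineticTheory.TendstoHydroFieldsAt (fun N =>
(Literature.MathematicalPhysics.KineticTheory.velMeasure (u 0) (θ 0) (q N)).map (fun v =>
Literature.MathematicalPhysics.KineticTheory.zipConfig (q N, v))) Φ ρ u θ t`

## Assembly
Pure quantifier bookkeeping, PROVED sorry-free as `theorem closes` (glue.lean; re-elaborated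
2026-08-16 after the statement re-type
p126922, rev 1; axioms propext / Classical.choice / Quot.sound): QuenchedToAnnealed fed with
QuenchedThermalHydro gives a band η₁ and,
profile by profile, a σ₁ below which every classical solution with ρσ³ ≤ η₁ on [0,T) is followed by
the local-Gibbs hard-sphere
fields; the re-typed conjunct `HydrodynamicLimit` (the sub-problem decl) IS this packing-guarded
form — η₀ := η₁, σ₀ := σ₁, its
strict guard ρσ³ < η₀ weakened to ≤ η₁ by le_of_lt — so the guard is supplied by the Statement's own
hypothesis, and the former third
hypothesis DiluteSelfConsistency (stmt-3091, which only discharged the guard of the old unguarded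
abbrev) is dropped from this route.
Binders of `closes` = the cruxes QuenchedThermalHydro (X, rank 0) and QuenchedToAnnealed (X →
Statement; crux by role at rank 9,
provable-now/L: once `theorem … : KickedOrbits.QuenchedToAnnealed` lands, the gate discharges it
inside `closes` and X stands alone).
The kicked crux is upstream of X through KickedImpliesQuenched and is deliberately NOT a hypothesis
of `closes` (X is weaker);
QuenchedCollisionFloor and KickedAntiHistory are the engine's first rung and the line's falsifiable
prediction, not hypotheses.

Rationale: WHY THIS LINE. Spohn1991 Ch. 9 asks for "an accessible criterion for good phase points" and explains
(§4.5, Ch. 9) that only IRREVERSIBLE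
macro-laws force probability; smooth Euler is reversible (I.3.2), so pre-shock hydrodynamics may be
a property of (almost
individual) microstates — the card's junction. Its audit and card sinai-steering-decides-dhl show
the every-point form is an
emptiness claim killed by (N+1)^(−K)-steered demons, so the line keeps the individual microstate and
a time-0-checkable
hypothesis (one-body Maxwellian typicality) and adds the smallest velocity blur; at full blur the
local Gibbs law disintegrates
EXACTLY as ∫(δ_q ⊗ Maxwellians) dLG_pos (proved: Literature `lintegral_localGibbsMeasure`,
`localGibbs_lln_holds`), so X →
conjunct is measure theory. Imported areas: smooth ergodic theory of hyperbolic billiards (standard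
pairs / conditional
equidistribution of impact parameters seeded by VELOCITY randomness only, ChernovDolgopyat2009;
engine card
one-flight-standard-pairs-kac) and quenched limit theorems (BoldrighiniBunimovichSinai1983,
doi:10.4007/annals.2011.174.1.7,
doi:10.1007/s00220-020-03852-8, doi:10.3390/e27040397: kinetic/diffusive limits for FIXED scatterer
configurations at and
beyond Boltzmann–Grad; doi:10.1214/ejp.v15-728: Euler hydrodynamics from deterministic initial
configurations with random
dynamics — here the mirror image: randomness in the initial velocities only;
BoldrighiniDobrushinSukhov1983: hard-rod Euler
limit for individual configurations; MatthiesTheil2009: with beam-like velocity laws kinetic limits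
FAIL, the reason the
hypothesis is Maxwellian typicality and the kick acts on velocities). Versus the board: every open
route of the sub is an
ENSEMBLE statement (entropy, LD, cumulants, mv weak–strong); SinaiSteeringDichotomy carries the
NEGATIVE individual-microstate
side (MacroSensitivity) and is complementary — its demons are exactly what the kick floor is set
against; negatives 9168/9236/
9238 are untouched (every Euler-quantified item here ties ρ(0) to the particle data, forcing ∫ρ(0) =
1, and guards the packing).

RANKED CRUXES. #0 QuenchedThermalHydro (target; auto-crux, rank 0) — X as in § Thesis — the conjunct
fibrewise over the position marginal: ∃ η₁ > 0 ∀ σ > 0 ∀ classical hs-Euler solutions on [0,T) with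
ρσ³ ≤ η₁ ∀ flow families ∀ position sequences q with velMeasure(u(0),θ(0))-a.e.-good fibre and
empirical density → ρ(0,·): fields of the orbit from (q_N, fresh Maxwellian velocities) converge in
probability to (ρ,ρu,E)(t), t ∈ (0,T) (card item 1 at full kick; conforming restatement of retired
stmt-7006 without a₀/LG/σ₀). [difficulty: open-problem] (why it might fail: Contains the conjunct
fibre by fibre: an unforeseen kick-proof POSITION pathology (mesoscale jammed grains / sheets /
contact chains that do not melt in o(1) time at packing ≤ η₁) or a dense pre-shock excursion inside
the band breaks it; σ-uniform band η₁ is a bet.) [Spohn1991, OllaVaradhanYau1993,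
doi:10.1214/ejp.v15-728, BoldrighiniBunimovichSinai1983, doi:10.1007/s00220-020-03852-8,
BoldrighiniDobrushinSukhov1983]
#2 KickedMicrostateHydro (crux) — (card item 1, DHL in kicked form) ∃ η₁ > 0 ∀ σ > 0 ∀ classical
hs-Euler solutions on [0,T) with ρσ³ ≤ η₁ ∀ flows ∀ kick schedules 0 < η_N ≤ 1 with η_N (N+1)^(1/3)
→ ∞ ∀ microstate sequences z_N that are ONE-BODY MAXWELLIAN TYPICAL (∫φ d emp(z_N) →
∫ρ(0,x)∫φ(x,v)M(1,θ(0,x),u(0,x))(v) for bounded continuous φ on 𝕋³×ℝ³, and ∫|v|² d emp →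
∫ρ(0)(|u(0)|²+3θ(0))) with kick-a.e.-good fibre: the orbit of the OU-kicked state vᵢ ↦
u(0,xᵢ)+√(1−η²)(vᵢ−u(0,xᵢ))+η√θ(0,xᵢ)ξᵢ (positions untouched) has fields → Euler in
kick-probability, t ∈ (0,T). η ≡ 1 is X (support KickedImpliesQuenched). One-body typicality
excludes the exact collisionless weaves (≤ 1/(2σ) direction families at fixed σ); the kick floor
N^(−1/3) = interparticle distance per unit time is set against steering. [difficulty: open-problem]
(why it might fail: Kick floor may be too low: if Sinai steering (card sinai-steering-decides-dhl,
MacroSensitivity of route SinaiSteeringDichotomy) yields bad sets of non-vanishing kick-measure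
around one-body-typical points at scales N^(−κ), κ < 1/3, schedules just above N^(−1/3) fail; pivot
= fixed η ∈ (0,1].) [Spohn1991, ChernovDolgopyat2009, MatthiesTheil2009,
doi:10.4007/annals.2011.174.1.7, doi:10.1103/physrevlett.64.1196, doi:10.1038/363411a0]
#3 QuenchedCollisionFloor (crux) — (card item 2, no transparent thermal gas, quenched and
Euler-free) for continuous ρ₀, θ₀ > 0, u₀, every σ > 0 and t > 0 there is c > 0 with: for every flow
family and every position sequence q_N with velMeasure(u₀,θ₀)-a.e.-good fibre and empirical density
→ ρ₀, the probability over V ~ ⊗ᵢ M(u₀(qᵢ),θ₀(qᵢ)) that the orbit has fewer than c(N+1)^(4/3)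
collisions on [0,t] tends to 0 — a positive fraction of the Boltzmann count σ²N^(4/3)t, uniformly in
the positions (conforming restatement of retired stmt-7008 with ∀σ). [difficulty: L] (why it might
fail: Velocity randomness is spent after one mean free time N^(−1/3): a floor over macroscopic [0,t]
uniform in ARBITRARY positions needs propagated equidistribution of impact parameters (N-uniform
standard pairs), unproved; self-organised transparency from designed positions is priced only at law
level.) [ChernovDolgopyat2009, Simanyi2013, Alexander1975, GST2013, BGSSAnnals2023,
SinaiChernov1987]
#4 KickedAntiHistory (crux) — (the card's Loschmidt content, kicked; hydrodynamic Loschmidt echo) ∃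
η₁ > 0 ∀ σ > 0 ∀ classical hs-Euler solutions on [0,T) with ρσ³ ≤ η₁ ∀ continuous positive profiles
(a₀,θ₀,u₀) ∀ flows whose local Gibbs laws satisfy the t = 0 LLN of the conjunct ∀ kick schedules as
in KickedMicrostateHydro ∀ t₁ ∈ (0,T) ∀ s ∈ [0,t₁]: draw w from the local Gibbs law, evolve to t₁,
OU-kick the velocities in the local Euler frame (u(t₁,·), θ(t₁,·)) with size η_N, flip all
velocities, evolve for time s (law written as ONE pushforward of LG_N ⊗ N(0,I)^(N+1) by a measurable
map — no Measure.bind, so no junk-zero kernel) — the fields converge in probability to (ρ, −ρu,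
E)(t₁ − s): an imperfectly reversed pre-shock history no longer retraces microscopically but
retraces MACROscopically (s = t₁ returns the mirror image of the initial profile). Consistent by
EulerReversal; predicted FALSE past the first shock (rarefaction instead of un-shocking) — the
card's frontier. [deps: KickedMicrostateHydro, EulerReversal] [difficulty: open-problem] (why it
might fail: Position-space memory survives a velocity-only kick: correlations built by Φ_(t₁) sit in
positions at scales ≥ N^(−1/3), so the kicked anti-history may partly un-evolve AHEAD of reversed
Euler before local equilibrium is re-imposed (echo decay is Lyapunov-limited, not kick-limited).)
[Spohn1991, doi:10.1016/0375-9601(67)90651-2, doi:10.1007/bf01048022,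
doi:10.1103/physrevlett.86.2490, doi:10.1038/ncomms4474, CIPDiluteGases1994, BodineauEtAl2019]
#9 EulerReversal (support) — (the typable core of the card's Loschmidt-compatibility lemma, provable
now) a classical hard-sphere Euler solution (ρ,u,θ) on [0,T) read backwards from any t₁ ∈ (0,T) with
u ↦ −u, i.e. (ρ(t₁−s), −u(t₁−s), θ(t₁−s)), is a classical solution on [0,t₁): mass and energy
equations are odd, momentum even under (s,u) ↦ (−s,−u); derivWithin on Ico 0 t₁ against the
two-sided derivative at interior times of Ico 0 T; ContDiffOn under the affine reflection.
[difficulty: provable-now] [Spohn1991, Kato1975, Majda1984, Dafermos1979]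
#9 KickedImpliesQuenched (support) — KickedMicrostateHydro → QuenchedThermalHydro: at η ≡ 1 the kick
law is (velMeasure (u 0) (θ 0) q).map zipConfig whatever the velocities of z (√(1−1) = 0, simp), and
for a density-typical admissible q there EXIST velocity assignments making z one-body Maxwellian
typical with convergent energy (probabilistic method: LLN for ⊗ᵢ M(u(0,qᵢ),θ(0,qᵢ)) on a countable
convergence-determining family + energy, diagonal choice; or a deterministic nearest-neighbour
matching with antithetic Gaussian quantiles). [difficulty: provable-now] [Spohn1991, Georgii1994]
#9 QuenchedToAnnealed (crux by role since the 2026-08-16 repair — an unproved binder of `closes`;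
provable-now, L) — X → the packing-guarded conjunct on the same band, i.e. the re-typed Statement
with guard ≤ η₁ (the frame statement "X → Statement"): ∃ η₁ > 0 ∀ profiles ∃ σ₀ ∀ σ < σ₀ ∀ classical
solutions with ρσ³ ≤ η₁ ∀ flows, t = 0 LLN ⇒ convergence at every t < T. Proof plan (provable now):
σ₀ := min(1/2, σ₀ of localGibbs_lln_holds); identification ρ(0)=ρ_LG, u(0)=u₀, θ(0)=θ₀ from the
hypothesis + proved LLN by uniqueness of in-probability limits and continuity; LG =
localGibbsMeasure disintegrates over posGibbsMeasure with fibres (velMeasure u₀ θ₀ q).map zipConfig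
(lintegral_localGibbsMeasure); fibres a.e. good (LG ≪ Liouville); Markov + a diagonal lemma over a
countable sup-dense family of χ give typical position sets T_N with posGibbs(T_N) → 1 all of whose
sequences satisfy X's hypotheses; if LG(Bad_N(t)) did not → 0, pick q_N ∈ T_N with fibre probability
≥ ε along a subsequence — contradicting X; t = 0 is the hypothesis. [difficulty: provable-now] (why
it might fail: only through a typing slip — the POINTWISE identification u(0,·) = u₀, θ(0,·) = θ₀
(X's fibre law is velMeasure (u 0) (θ 0) q, LG's is velMeasure u₀ θ₀ q; uses ρ₀ > 0 of
localGibbs_lln_holds and Euler smoothness at t = 0) or the extraction of ONE position sequence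
typical for all χ ∈ C(𝕋³) from in-probability limits.) [Spohn1991, Georgii1994, Ruelle1969,
OllaVaradhanYau1993]

TWO-LAYER PLAN. Foreseen glued splits (k ≤ 3, depth 1; nothing filed now). QuenchedThermalHydro ⇐
QuenchedFluxClosure (time-integrated empirical
momentum/energy fluxes of the quenched law close on the Euler fluxes with p = ρθZ(ρσ³) — the
quenched twin of FluxClosure of route
BoxDissipativeWeakStrong) → QuenchedRelativeEnergyStability (BF18 weak–strong Gronwall in
V-expectation, sharing HsEntropyConvex /
HsEosLowDensity) → QuenchedThermalHydro. QuenchedCollisionFloor ⇐ FirstWindowFloor (≥ cNτ collisions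
on [0, τN^(−1/3)] from the
statics of q + Maxwellian velocities, provable) → PropagatedFloor (B1-type conditional
equidistribution keeps the rate) →
QuenchedCollisionFloor. KickedMicrostateHydro ⇐ KickBallLLN (bad sets have vanishing kick-measure
around one-body-typical points:
a mesoscopic-ball law of large numbers) → QuenchedThermalHydro-type closure → KickedMicrostateHydro.
KickedAntiHistory ⇐
KickedMicrostateHydro + OneBodyLocalEquilibrium(t₁) (the evolved law is one-body Maxwellian typical
for (ρ,u,θ)(t₁) in probability)
+ EulerReversal, glued by the diagonal lemma of QuenchedToAnnealed.

KILL CRITERIA. A density-typical admissible position sequence inside the band whose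
Maxwellian-velocity orbits deviate from Euler pre-shock with
non-vanishing probability refutes X and closes the route (`close --reason
refuted:QuenchedThermalHydro`) — summit-level negative
knowledge (the conjunct then fails fibrewise). ¬KickedMicrostateHydro by a schedule with η_N N^(1/3)
→ ∞ while X stands ⇒ ONE
restatement with a larger kick floor (η_N ≥ N^(−κ), κ < 1/3, or η fixed); a proof of
MacroSensitivity with kick-measure control
forces the same. ¬QuenchedCollisionFloor (a quenched transparent thermal gas) kills the intended
engine and, unless the witness is
non-generic in a way X excludes, X itself. ¬KickedAntiHistory pre-shock with KickedMicrostateHydro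
standing falsifies "kick ⇒ fresh
one-body local equilibrium" and the item is dropped (not load-bearing). A dense pre-shock excursion
(¬DiluteSelfConsistency, stmt-3091,
now wanted only by other routes) no longer touches this route: since the re-type p126922 the
conjunct itself is packing-guarded and
`closes` needs no density bound. ¬QuenchedToAnnealed is conceivable only through a typing slip
(identification / diagonal selection)
and would be answered by ONE restatement of X over the profiles' fibre law velMeasure u₀ θ₀, not by
retirement. HydrodynamicLimit proved by an
ensemble route moots `closes` but not X / KickedMicrostateHydro (strictly stronger): supersede or
keep for them alone.

NOT DECOMPOSED YET. The engine (standard pairs seeded by velocity randomness only; growth lemmas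
N-uniform at small packing) — layer-2 children of
QuenchedCollisionFloor / QuenchedThermalHydro once either moves. Sharpness below the kick floor
(N^(−K'') ≪ η_N ≪ N^(−1/3)) is
deliberately not filed: exact transparent weaves are excluded by one-body typicality, the only
sub-floor enemy is steering, and a
typed ¬-statement waits for MacroSensitivity. Post-shock failure of KickedAntiHistory needs entropy
solutions of hs-Euler
(WildSolutions / NoBVEstimatesMultiD territory; IsHsEulerWeakEntropySolution exists but no
post-shock LLN). Velocity tails / uniform
integrability along the orbit (HighMomentumCutoff burden) ride inside the cruxes' proofs. The
identification lemma and the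
diagonal/separability lemmas of QuenchedToAnnealed are `--supports` material. The card's negative
item 5 and its R-covariant
typicality class 𝒯 (Palm–Gibbs local statistics) are not typed: the kicked/quenched forms need no
new definition.

CHEAPEST FALSIFIER. Pencil first (done while planning, NOTES.md): can a ONE-BODY MAXWELLIAN TYPICAL
sequence be exactly collisionless at fixed σ? No — skew tube families in M directions avoid each
other only while 2σ(M−1) < 1, so exact weaves carry ≤ 1/(2σ) velocity directions and
are never Maxwellian-typical; bundled co-moving beams (which DO defeat a fields-only hypothesis for
every vanishing kick — this
killed my first draft of KickedMicrostateHydro) are excluded the same way. Machine next (not run: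
compute-free hub; a refuter may
`kit compute submit`): event-driven MD, N = 10⁴–10⁶ spheres at packing 0.02–0.05, smooth density
bump, u₀ = 0: (a) QUENCHED test —
structured positions (simple-cubic lattice; random close-packed mesoscale grains; planar sheets)
with the same coarse density,
Maxwellian velocities drawn once, compare density/momentum profiles at 0.2–1 sound times with the
local-Gibbs run: X predicts
agreement to O(N^(−1/2) + grain size); (b) ECHO test — evolve local Gibbs data to t₁, Gaussian
velocity kick η ∈ [N^(−1/2),
10N^(−1/3), 0.1], flip, evolve: KickedAntiHistory predicts macroscopic retracing for every η ≪ 1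
above N^(−1/3) pre-shock and its
failure past T*.

NUMBERS. Fixed reduced density: ε_N = σ(N+1)^(−1/3), (N+1)ε³ = σ³; ∫ρ(0) = 1 so the guard ρσ³ ≤ η₁
forces σ³ ≤ η₁; mean free path ≍
N^(−1/3)/(√2πσ²) (macroscopic units), collisions per particle per unit time ≍ 4√π σ²ρ√θ (N+1)^(1/3),
total on [0,t] ≍
2√πσ²N^(4/3)t (QuenchedCollisionFloor asks a fixed fraction c). Kick floor: η_N (N+1)^(1/3) → ∞,
i.e. kick displacement per unit
time ≫ interparticle distance N^(−1/3) = ε/σ; OU kick leaves ⊗ᵢM(u(0,xᵢ),θ(0,xᵢ)) invariant for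
every η ∈ (0,1] (variances
(1−η²)θ + η²θ = θ). Exact collisionless weaves: ≤ 1/(2σ) direction families (shadow fraction 2σ per
family on a transversal).
Steering scale (card sinai-steering-decides-dhl): demons at (N+1)^(−K), any K, within t ≍
A·K·N^(−1/3) log N. Items at open: 9
(1 target, 3 cruxes, 4 supports, 1 assembly); after the 2026-08-16 repair (statement re-type
p126922): 8 (X auto-crux, 3 cruxes,
QuenchedToAnnealed crux-by-role, 2 supports, 1 assembly; DiluteSelfConsistency dropped, `closes`
binders = X + QuenchedToAnnealed); every signature ≤ 2.1 k chars; Sketch.lean / Sketch1.lean rc 0.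

DEFINITION REQUESTS. None. Kick and quenched laws are inlined over
Literature.MathematicalPhysics.KineticTheory.gaussMeasure / velMeasure / zipConfig
(HardSphereEulerProofs, imported via front-matter `imports`), collision counts over
Literature.Analysis.FluidPDE.numCollisions, the
flip over Literature.Analysis.FluidPDE.flipVel. A convenience abbreviation `ouKickLaw` under
Summits/AtomisticToContinuum/
HydrodynamicLimit/Theorems would shorten three items and may be requested by the first prover; no
Literature fact is wanted
(localGibbs_lln_holds is proved; nothing unproved is imported).

Novelty: Searches (2026-08-15): board — all Theses/*.lean of the sub (grep
quench|velMeasure|zipConfig|Kicked|Loschmidt: only the retired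
predecessor KickedTypicalMicrostate and SinaiSteering(Dichotomy) touch the mechanism), card file +
its audit, `ledger negatives
--problem AtomisticToContinuum` (6); `lit frontier AtomisticToContinuum --since 2022` (30 rows:
Bose/Fermi gas, DHM Bourbaki
arXiv:2602.04407, arXiv:2310.13338 heat equation from deterministic dynamics — nothing
quenched-in-data); `lit bridges --cross any`
(irrelevant); `lit search --source crossref`: "strong hydrodynamic limit … deterministic initial
data" (doi:10.1214/ejp.v15-728,
doi:10.1016/0304-4149(94)90017-5), "Boltzmann–Grad limit periodic Lorentz gas quenched"
(doi:10.4007/annals.2011.174.1.7,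
doi:10.3390/e27040397, doi:10.1007/s00220-020-03852-8, doi:10.3934/krm.2022001), "hard rod
caricature" (doi:10.1007/bf01019499),
"molecular dynamics time reversibility velocity inversion" (doi:10.1016/0375-9601(67)90651-2,
doi:10.1007/bf01048022,
doi:10.1038/ncomms4474), "Jalabert Pastawski" (doi:10.1103/physrevlett.86.2490); `lit search
--source arxiv` "hard sphere gas
hydrodynamic limit random velocities typical configuration" (0); `lit galaxy search --star all` ×3
("hydrodynamic limit from
deterministic initial configurations", "deterministic initial data hydrodynamic", "anti-kinetic": 0
relevant); local searchd /
hybrid index unavailable this session (rc 75, logged in NOTES.md).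
Nearest prior art found: doi:10.1214/ejp.v1  [refs: 10.1214/ejp.v15-728, 10.1016/0304-4149(94, 10.4007/annals.2011.174.1.7, 10.3390/e27040397, 10.1007/s00220-020-03852-8, 10.3934/krm.2022001, 10.1007/bf01019499, 10.1016/0375-9601(67, 10.1007/bf01048022, 10.1038/ncomms4474, 10.1103/physrevlett.86.2490, 2602.04407, 2310.13338, doi:10.1214/ejp.v15-728, doi:10.1016/0304-4149, doi:10.4007/annals.2011.174.1.7, doi:10.3390/e27040397, doi:10.1007/s00220-02]

Barriers (technique_class: individual-orbit, quenched-kick, statement-design): - technique_class: individual-orbit, quenched-kick, statement-design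
- Literature.Barriers.AtomisticToContinuum.VelocityReversalBarrier: evaded on both counts its kernel
needs — the derivation is not sure (conclusion in kick/velocity-probability, weaker than the
individual time-0 hypothesis: Spohn's escape (i)) and the macro-law used is classical pre-shock
Euler, reversible (escape (iii)); KickedAntiHistory uses reversal positively and predicts its own
failure past the shock, where the barrier bites.
- Literature.Barriers.AtomisticToContinuum.VelocityReversalBarrierNarrow: the hypothesis classes
(density-typical positions + fresh Maxwellians; one-body typical + kick) are one-sided/forward in
the sense of caveat (e); no reversal-closed sure class is claimed anywhere.
- Literature.Barriers.AtomisticToContinuum.BoltzmannHypothesisBarrier: not met formally (no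
relative-entropy closure, no classification of stationary states); in substance
QuenchedCollisionFloor / the flux-closure child ARE quantitative chaos hypotheses — conceded: the
bet is that velocity randomness alone seeds N-uniform equidistribution of impact parameters
(standard pairs); its kernels (ideal gas, hard rods) are other dynamics — every item quantifies over
HardSphereFlow at fixed σ — and their in-model shadows (collisionless weaves, beams) are excluded by
one-body typicality and set the kick floor.
- Literature.Barriers.AtomisticToContinuum.BoltzmannHypothesisBarrierNarrow: same; the flux-level
identification is

History (route lifecycle, newest last):
- 2026-08-16T03:46:23Z · AUTO-CRUX (backfill): QuenchedThermalHydro — hypotheses of the deciding theorem that nothing in the route derives are cruxes (operator:999:586464)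
- 2026-08-16T23:27:53Z · rev 3: restated Assembly (stmt-AtomisticToContinuum-13146) — route-repair (p126922) step 3/3: the re-typed conjunct is packing-guarded, so DiluteSelfConsistency (stmt-3091, shared; it only discharged the guard of the old (planner-rrepair-AtomisticToContinuum-KickedOrb-862484e9-0)
- 2026-08-16T23:27:53Z · rev 3: dropped DiluteSelfConsistency — route-repair (p126922) step 3/3: the re-typed conjunct is packing-guarded, so DiluteSelfConsistency (stmt-3091, shared; it only discharged the guard of the old (planner-rrepair-AtomisticToContinuum-KickedOrb-862484e9-0)
- 2026-08-23T08:16:24Z · DORMANT — reconciler: no traction for 6 d (last activity statement-grounded at 2026-08-17T07:35:55Z); parked, not closed — `ledger route dormant route-AtomisticToContinuu (operator:999:1974168)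

sub-problem: HydrodynamicLimit · status: dormant · opened planner-plancard-AtomisticToContinuum-Hydrody-cb89e0ea-g2-0 2026-08-15T19:00:29Z · rev 4 · ledger route-AtomisticToContinuum-KickedOrbits
GENERATED by the gate from the ledger (D-0016/17). Provers cite these decls: `theorem foo : Summit.AtomisticToContinuum.HydrodynamicLimit.Theses.KickedOrbits.<Decl> := …` in Summits/AtomisticToContinuum/HydrodynamicLimit/Theorems/<Name>.lean.
-/

namespace Summit.AtomisticToContinuum.HydrodynamicLimit.Theses.KickedOrbits

open scoped BigOperators Topology Manifold Classical MeasureTheory ProbabilityTheory Matrix InnerProductSpace ComplexConjugate ContinuousMap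
open Filter Set Function TopologicalSpace MeasureTheory

attribute [summit_statement] _root_.HydrodynamicLimit

/-- item stmt-AtomisticToContinuum-13139 · crux (kind.auto-crux: conjecture-grade) · rank 0 · open · by planner
why it might fail: Contains the conjunct fibre by fibre: an unforeseen kick-proof POSITION pathology (mesoscale jammed grains / sheets / contact chains that do not melt in o(1) time at packing ≤ η₁) or a dense pre-shock excursion inside the band breaks it; σ-uniform band η₁ is a bet.
sources: Spohn1991, OllaVaradhanYau1993, doi:10.1214/ejp.v15-728, BoldrighiniBunimovichSinai1983, doi:10.1007/s00220-020-03852-8, BoldrighiniDobrushinSukhov1983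
[target] X as in § Thesis — the conjunct fibrewise over the position marginal: ∃ η₁ > 0 ∀ σ > 0 ∀
classical hs-Euler solutions on [0,T) with ρσ³ ≤ η₁ ∀ flow families ∀ position sequences q with
velMeasure(u(0),θ(0))-a.e.-good fibre and empirical density → ρ(0,·): fields of the orbit from (q_N,
fresh Maxwellian velocities) converge in probability to (ρ,ρu,E)(t), t ∈ (0,T) (card item 1 at full
kick; conforming restatement of retired stmt-7006 without a₀/LG/σ₀). [difficulty: open-problem] -/
@[route_item "route-AtomisticToContinuum-KickedOrbits", crux]
def QuenchedThermalHydro : Prop :=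
  ∃ η₁ : ℝ, 0 < η₁ ∧ ∀ σ : ℝ, 0 < σ → ∀ (T : ℝ) (ρ θ : ℝ → Literature.MathematicalPhysics.KineticTheory.T3 → ℝ) (u : ℝ → Literature.MathematicalPhysics.KineticTheory.T3 → Literature.MathematicalPhysics.KineticTheory.V3), Literature.MathematicalPhysics.KineticTheory.IsHardSphereEulerSolution σ T ρ u θ → (∀ t ∈ Set.Ico 0 T, ∀ x, ρ t x * σ ^ 3 ≤ η₁) → ∀ Φ : (N : ℕ) → Literature.Analysis.FluidPDE.HardSphereFlow (Literature.Analysis.FluidPDE.Torus.geometry (Fin 3)) (Literature.MathematicalPhysics.KineticTheory.hsDiameter σ N) (N + 1), ∀ q : (N : ℕ) → (Fin (N + 1) → Literature.MathematicalPhysics.KineticTheory.T3), (∀ N, ∀ᵐ v ∂(Literature.MathematicalPhysics.KineticTheory.velMeasure (u 0) (θ 0) (q N)), Literature.MathematicalPhysics.KineticTheory.zipConfig (q N, v) ∈ (Φ N).good) → (∀ χ : Literature.MathematicalPhysics.KineticTheory.T3 → ℝ, Continuous χ → Filter.Tendsto (fun N : ℕ => ((N + 1 : ℕ) : ℝ)⁻¹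 * ∑ i, χ (q N i)) Filter.atTop (nhds (∫ x, χ x * ρ 0 x))) → ∀ t ∈ Set.Ioo 0 T, Literature.MathematicalPhysics.KineticTheory.TendstoHydroFieldsAt (fun N => (Literature.MathematicalPhysics.KineticTheory.velMeasure (u 0) (θ 0) (q N)).map (fun v => Literature.MathematicalPhysics.KineticTheory.zipConfig (q N, v))) Φ ρ u θ t

/-- item stmt-AtomisticToContinuum-13140 · crux · rank 2 · open · by planner
why it might fail: Kick floor may be too low: if Sinai steering (card sinai-steering-decides-dhl, MacroSensitivity of route SinaiSteeringDichotomy) yields bad sets of non-vanishing kick-measure around one-body-typical points at scales N^(−κ), κ < 1/3, schedules just above N^(−1/3) fail; pivot = fixed η ∈ (0,1].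
sources: Spohn1991, ChernovDolgopyat2009, MatthiesTheil2009, doi:10.4007/annals.2011.174.1.7, doi:10.1103/physrevlett.64.1196, doi:10.1038/363411a0
[crux] (card item 1, DHL in kicked form) ∃ η₁ > 0 ∀ σ > 0 ∀ classical hs-Euler solutions on [0,T)
with ρσ³ ≤ η₁ ∀ flows ∀ kick schedules 0 < η_N ≤ 1 with η_N (N+1)^(1/3) → ∞ ∀ microstate sequences
z_N that are ONE-BODY MAXWELLIAN TYPICAL (∫φ d emp(z_N) → ∫ρ(0,x)∫φ(x,v)M(1,θ(0,x),u(0,x))(v) for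
bounded continuous φ on 𝕋³×ℝ³, and ∫|v|² d emp → ∫ρ(0)(|u(0)|²+3θ(0))) with kick-a.e.-good fibre:
the orbit of the OU-kicked state vᵢ ↦ u(0,xᵢ)+√(1−η²)(vᵢ−u(0,xᵢ))+η√θ(0,xᵢ)ξᵢ (positions untouched)
has fields → Euler in kick-probability, t ∈ (0,T). η ≡ 1 is X (support KickedImpliesQuenched).
One-body typicality excludes the exact collisionless weaves (≤ 1/(2σ) direction families at fixed
σ); the kick floor N^(−1/3) = interparticle distance per unit time is set against steering.
[difficulty: open-problem] -/
@[route_item "route-AtomisticToContinuum-KickedOrbits"]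
def KickedMicrostateHydro : Prop :=
  ∃ η₁ : ℝ, 0 < η₁ ∧ ∀ σ : ℝ, 0 < σ → ∀ (T : ℝ) (ρ θ : ℝ → Literature.MathematicalPhysics.KineticTheory.T3 → ℝ) (u : ℝ → Literature.MathematicalPhysics.KineticTheory.T3 → Literature.MathematicalPhysics.KineticTheory.V3), Literature.MathematicalPhysics.KineticTheory.IsHardSphereEulerSolution σ T ρ u θ → (∀ t ∈ Set.Ico 0 T, ∀ x, ρ t x * σ ^ 3 ≤ η₁) → ∀ Φ : (N : ℕ) → Literature.Analysis.FluidPDE.HardSphereFlow (Literature.Analysis.FluidPDE.Torus.geometry (Fin 3)) (Literature.MathematicalPhysics.KineticTheory.hsDiameter σ N) (N + 1), ∀ η : ℕ → ℝ, (∀ N, 0 < η N ∧ η N ≤ 1) → Filter.Tendsto (fun N : ℕ => η N * ((N + 1 : ℕ) : ℝ) ^ (1 / 3 : ℝ)) Filter.atTop Filter.atTop → ∀ z : (N : ℕ) → Literature.Analysis.FluidPDE.Config (N + 1) (Fin 3) Literature.MathematicalPhysics.KineticTheory.T3, (∀ N, ∀ᵐ w ∂((MeasureTheory.Measure.pi (fun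 i : Fin (N + 1) => Literature.MathematicalPhysics.KineticTheory.gaussMeasure (u 0 (z N i).1 + Real.sqrt (1 - (η N) ^ 2) • ((z N i).2 - u 0 (z N i).1)) ((η N) ^ 2 * θ 0 (z N i).1))).map (fun v => Literature.MathematicalPhysics.KineticTheory.zipConfig (fun i => (z N i).1, v))), w ∈ (Φ N).good) → (∀ φ : BoundedContinuousFunction (Literature.MathematicalPhysics.KineticTheory.T3 × Literature.MathematicalPhysics.KineticTheory.V3) ℝ, Filter.Tendsto (fun N : ℕ => ∫ y, φ y ∂(Literature.Analysis.FluidPDE.empiricalMeasure (z N))) Filter.atTop (nhds (∫ x, ρ 0 x * ∫ v, φ (x, v) * Literature.Analysis.FluidPDE.localMaxwellian 1 (θ 0 x) (u 0 x) v))) → Filter.Tendsto (fun N : ℕ => ∫ y, ‖y.2‖ ^ 2 ∂(Literature.Analysis.FluidPDE.empiricalMeasure (z N))) Filter.atTop (nhds (∫ x, ρ 0 x * (‖u 0 x‖ ^ 2 + 3 * θ 0 x))) → ∀ t ∈ Set.Ioo 0 T, Literature.MathematicalPhysics.KineticTheory.TendstoHydroFieldsAt (fun N => (MeasureTheory.Measure.pi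 (fun i : Fin (N + 1) => Literature.MathematicalPhysics.KineticTheory.gaussMeasure (u 0 (z N i).1 + Real.sqrt (1 - (η N) ^ 2) • ((z N i).2 - u 0 (z N i).1)) ((η N) ^ 2 * θ 0 (z N i).1))).map (fun v => Literature.MathematicalPhysics.KineticTheory.zipConfig (fun i => (z N i).1, v))) Φ ρ u θ t

/-- item stmt-AtomisticToContinuum-13141 · crux · rank 3 · open · by planner
why it might fail: Velocity randomness is spent after one mean free time N^(−1/3): a floor over macroscopic [0,t] uniform in ARBITRARY positions needs propagated equidistribution of impact parameters (N-uniform standard pairs), unproved; self-organised transparency from designed positions is priced only at law level.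
sources: ChernovDolgopyat2009, Simanyi2013, Alexander1975, GST2013, BGSSAnnals2023, SinaiChernov1987
[crux] (card item 2, no transparent thermal gas, quenched and Euler-free) for continuous ρ₀, θ₀ > 0,
u₀, every σ > 0 and t > 0 there is c > 0 with: for every flow family and every position sequence q_N
with velMeasure(u₀,θ₀)-a.e.-good fibre and empirical density → ρ₀, the probability over V ~ ⊗ᵢ
M(u₀(qᵢ),θ₀(qᵢ)) that the orbit has fewer than c(N+1)^(4/3) collisions on [0,t] tends to 0 — a
positive fraction of the Boltzmann count σ²N^(4/3)t, uniformly in the positions (conforming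
restatement of retired stmt-7008 with ∀σ). [difficulty: L] -/
@[route_item "route-AtomisticToContinuum-KickedOrbits"]
def QuenchedCollisionFloor : Prop :=
  ∀ (ρ₀ θ₀ : Literature.MathematicalPhysics.KineticTheory.T3 → ℝ) (u₀ : Literature.MathematicalPhysics.KineticTheory.T3 → Literature.MathematicalPhysics.KineticTheory.V3), Continuous ρ₀ → Continuous θ₀ → Continuous u₀ → (∀ x, 0 < ρ₀ x) → (∀ x, 0 < θ₀ x) → ∀ σ : ℝ, 0 < σ → ∀ t : ℝ, 0 < t → ∃ c : ℝ, 0 < c ∧ ∀ Φ : (N : ℕ) → Literature.Analysis.FluidPDE.HardSphereFlow (Literature.Analysis.FluidPDE.Torus.geometry (Fin 3)) (Literature.MathematicalPhysics.KineticTheory.hsDiameter σ N) (N + 1), ∀ q : (N : ℕ) → (Fin (N + 1) → Literature.MathematicalPhysics.KineticTheory.T3), (∀ N, ∀ᵐ v ∂(Literature.MathematicalPhysics.KineticTheory.velMeasure u₀ θ₀ (q N)), Literature.MathematicalPhysics.KineticTheory.zipConfig (q N, v) ∈ (Φ N).good) → (∀ χ : Literature.MathematicalPhysics.KineticTheory.T3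 → ℝ, Continuous χ → Filter.Tendsto (fun N : ℕ => ((N + 1 : ℕ) : ℝ)⁻¹ * ∑ i, χ (q N i)) Filter.atTop (nhds (∫ x, χ x * ρ₀ x))) → Filter.Tendsto (fun N : ℕ => ((Literature.MathematicalPhysics.KineticTheory.velMeasure u₀ θ₀ (q N)).map (fun v => Literature.MathematicalPhysics.KineticTheory.zipConfig (q N, v))) {z | (Literature.Analysis.FluidPDE.numCollisions (Literature.Analysis.FluidPDE.Torus.geometry (Fin 3)) (Literature.MathematicalPhysics.KineticTheory.hsDiameter σ N) (fun s => (Φ N).flow s z) 0 t : ℝ) < c * ((N + 1 : ℕ) : ℝ) ^ (4 / 3 : ℝ)}) Filter.atTop (nhds 0)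

/-- item stmt-AtomisticToContinuum-13142 · crux · rank 4 · open · by planner
why it might fail: Position-space memory survives a velocity-only kick: correlations built by Φ_(t₁) sit in positions at scales ≥ N^(−1/3), so the kicked anti-history may partly un-evolve AHEAD of reversed Euler before local equilibrium is re-imposed (echo decay is Lyapunov-limited, not kick-limited).
sources: Spohn1991, doi:10.1016/0375-9601(67)90651-2, doi:10.1007/bf01048022, doi:10.1103/physrevlett.86.2490, doi:10.1038/ncomms4474, CIPDiluteGases1994
[crux] (the card's Loschmidt content, kicked; hydrodynamic Loschmidt echo) ∃ η₁ > 0 ∀ σ > 0 ∀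
classical hs-Euler solutions on [0,T) with ρσ³ ≤ η₁ ∀ continuous positive profiles (a₀,θ₀,u₀) ∀
flows whose local Gibbs laws satisfy the t = 0 LLN of the conjunct ∀ kick schedules as in
KickedMicrostateHydro ∀ t₁ ∈ (0,T) ∀ s ∈ [0,t₁]: draw w from the local Gibbs law, evolve to t₁,
OU-kick the velocities in the local Euler frame (u(t₁,·), θ(t₁,·)) with size η_N, flip all
velocities, evolve for time s (law written as ONE pushforward of LG_N ⊗ N(0,I)^(N+1) by a measurable
map — no Measure.bind, so no junk-zero kernel) — the fields converge in probability to (ρ, −ρu,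
E)(t₁ − s): an imperfectly reversed pre-shock history no longer retraces microscopically but
retraces MACROscopically (s = t₁ returns the mirror image of the initial profile). Consistent by
EulerReversal; predicted FALSE past the first shock (rarefaction instead of un-shocking) — the
card's frontier. [deps: KickedMicrostateHydro, EulerReversal] [difficulty: open-problem] -/
@[route_item "route-AtomisticToContinuum-KickedOrbits"]
def KickedAntiHistory : Prop :=
  ∃ η₁ : ℝ, 0 < η₁ ∧ ∀ σ : ℝ, 0 < σ → ∀ (T : ℝ) (ρ θ : ℝ → Literature.MathematicalPhysics.KineticTheory.T3 → ℝ) (u : ℝ → Literature.MathematicalPhysics.KineticTheory.T3 → Literature.MathematicalPhysics.KineticTheory.V3), Literature.MathematicalPhysics.KineticTheory.IsHardSphereEulerSolution σ T ρ u θ → (∀ t ∈ Set.Ico 0 T, ∀ x, ρ t x * σ ^ 3 ≤ η₁) → ∀ (a₀ θ₀ : Literature.MathematicalPhysics.KineticTheory.T3 → ℝ) (u₀ : Literature.MathematicalPhysics.KineticTheory.T3 → Literature.MathematicalPhysics.KineticTheory.V3), Continuous a₀ → Continuous θ₀ → Continuous u₀ → (∀ x, 0 < a₀ x) → (∀ x,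 0 < θ₀ x) → ∀ Φ : (N : ℕ) → Literature.Analysis.FluidPDE.HardSphereFlow (Literature.Analysis.FluidPDE.Torus.geometry (Fin 3)) (Literature.MathematicalPhysics.KineticTheory.hsDiameter σ N) (N + 1), Literature.MathematicalPhysics.KineticTheory.TendstoHydroFieldsAt (fun N => Literature.MathematicalPhysics.KineticTheory.localGibbsLaw σ a₀ u₀ θ₀ N (Φ N)) Φ ρ u θ 0 → ∀ η : ℕ → ℝ, (∀ N, 0 < η N ∧ η N ≤ 1) → Filter.Tendsto (fun N : ℕ => η N * ((N + 1 : ℕ) : ℝ) ^ (1 / 3 : ℝ)) Filter.atTop Filter.atTop → ∀ t₁ ∈ Set.Ioo 0 T, ∀ s ∈ Set.Icc 0 t₁, Literature.MathematicalPhysics.KineticTheory.TendstoHydroFieldsAt (fun N => ((Literature.MathematicalPhysics.KineticTheory.localGibbsLaw σ a₀ u₀ θ₀ N (Φ N)).prod (MeasureTheory.Measure.pi (fun _ : Fin (N + 1) => Literature.MathematicalPhysics.KineticTheory.gaussMeasure (0 : Literature.MathematicalPhysics.KineticTheory.V3) 1))).map (fun p => Literature.Analysis.FluidPDE.flipVel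 (Literature.MathematicalPhysics.KineticTheory.zipConfig (fun i => ((Φ N).flow t₁ p.1 i).1, fun i => u t₁ ((Φ N).flow t₁ p.1 i).1 + Real.sqrt (1 - (η N) ^ 2) • (((Φ N).flow t₁ p.1 i).2 - u t₁ ((Φ N).flow t₁ p.1 i).1) + (η N * Real.sqrt (θ t₁ ((Φ N).flow t₁ p.1 i).1)) • p.2 i)))) Φ (fun r x => ρ (t₁ - r) x) (fun r x => -u (t₁ - r) x) (fun r x => θ (t₁ - r) x) s

/-- item stmt-AtomisticToContinuum-13145 · crux · rank 9 · open · by planner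
why it might fail: Unproved `closes` binder (provable-now, L): fails as typed only if the POINTWISE identification u(0,·)=u₀, θ(0,·)=θ₀ (X's fibre law is velMeasure (u 0) (θ 0) q, LG's is velMeasure u₀ θ₀ q) or ONE position sequence typical for all χ ∈ C(𝕋³) cannot be extracted from in-probability limits.
sources: Spohn1991, Georgii1994, Ruelle1969, OllaVaradhanYau1993
[support] X → the packing-guarded conjunct on the same band (the frame statement "X → Statement" up
to the guard): ∃ η₁ > 0 ∀ profiles ∃ σ₀ ∀ σ < σ₀ ∀ classical solutions with ρσ³ ≤ η₁ ∀ flows, t = 0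
LLN ⇒ convergence at every t < T. Proof plan (provable now): σ₀ := min(1/2, σ₀ of
localGibbs_lln_holds); identification ρ(0)=ρ_LG, u(0)=u₀, θ(0)=θ₀ from the hypothesis + proved LLN
by uniqueness of in-probability limits and continuity; LG = localGibbsMeasure disintegrates over
posGibbsMeasure with fibres (velMeasure u₀ θ₀ q).map zipConfig (lintegral_localGibbsMeasure); fibres
a.e. good (LG ≪ Liouville); Markov + a diagonal lemma over a countable sup-dense family of χ give
typical position sets T_N with posGibbs(T_N) → 1 all of whose sequences satisfy X's hypotheses; if
LG(Bad_N(t)) did not → 0, pick q_N ∈ T_N with fibre probability ≥ ε along a subsequence —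
contradicting X; t = 0 is the hypothesis. [difficulty: provable-now] -/
@[route_item "route-AtomisticToContinuum-KickedOrbits", crux]
def QuenchedToAnnealed : Prop :=
  QuenchedThermalHydro → ∃ η₁ : ℝ, 0 < η₁ ∧ ∀ (a₀ θ₀ : Literature.MathematicalPhysics.KineticTheory.T3 → ℝ) (u₀ : Literature.MathematicalPhysics.KineticTheory.T3 → Literature.MathematicalPhysics.KineticTheory.V3), Continuous a₀ → Continuous θ₀ → Continuous u₀ → (∀ x, 0 < a₀ x) → (∀ x, 0 < θ₀ x) → ∃ σ₀ : ℝ, 0 < σ₀ ∧ ∀ σ : ℝ, 0 < σ → σ < σ₀ → ∀ (T : ℝ) (ρ θ : ℝ → Literature.MathematicalPhysics.KineticTheory.T3 → ℝ) (u : ℝ → Literature.MathematicalPhysics.KineticTheory.T3 → Literature.MathematicalPhysics.KineticTheory.V3), Literature.MathematicalPhysics.KineticTheory.IsHardSphereEulerSolution σ T ρ u θ → (∀ t ∈ Set.Ico 0 T, ∀ x, ρ t x * σ ^ 3 ≤ η₁) → ∀ Φ : (N : ℕ) → Literature.Analysis.FluidPDE.HardSphereFlow (Literature.Analysis.FluidPDE.Torus.geometry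 (Fin 3)) (Literature.MathematicalPhysics.KineticTheory.hsDiameter σ N) (N + 1), Literature.MathematicalPhysics.KineticTheory.TendstoHydroFieldsAt (fun N => Literature.MathematicalPhysics.KineticTheory.localGibbsLaw σ a₀ u₀ θ₀ N (Φ N)) Φ ρ u θ 0 → ∀ t ∈ Set.Ico 0 T, Literature.MathematicalPhysics.KineticTheory.TendstoHydroFieldsAt (fun N => Literature.MathematicalPhysics.KineticTheory.localGibbsLaw σ a₀ u₀ θ₀ N (Φ N)) Φ ρ u θ t

/-- item stmt-AtomisticToContinuum-13143 · support · rank 9 · open · by planner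
sources: Spohn1991, Kato1975, Majda1984, Dafermos1979
[support] (the typable core of the card's Loschmidt-compatibility lemma, provable now) a classical
hard-sphere Euler solution (ρ,u,θ) on [0,T) read backwards from any t₁ ∈ (0,T) with u ↦ −u, i.e.
(ρ(t₁−s), −u(t₁−s), θ(t₁−s)), is a classical solution on [0,t₁): mass and energy equations are odd,
momentum even under (s,u) ↦ (−s,−u); derivWithin on Ico 0 t₁ against the two-sided derivative at
interior times of Ico 0 T; ContDiffOn under the affine reflection. [difficulty: provable-now] -/
@[route_item "route-AtomisticToContinuum-KickedOrbits"]
def EulerReversal : Prop :=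
  ∀ (σ T : ℝ) (ρ θ : ℝ → Literature.MathematicalPhysics.KineticTheory.T3 → ℝ) (u : ℝ → Literature.MathematicalPhysics.KineticTheory.T3 → Literature.MathematicalPhysics.KineticTheory.V3), Literature.MathematicalPhysics.KineticTheory.IsHardSphereEulerSolution σ T ρ u θ → ∀ t₁ ∈ Set.Ioo 0 T, Literature.MathematicalPhysics.KineticTheory.IsHardSphereEulerSolution σ t₁ (fun s x => ρ (t₁ - s) x) (fun s x => -u (t₁ - s) x) (fun s x => θ (t₁ - s) x)

/-- item stmt-AtomisticToContinuum-13144 · support · rank 9 · open · by planner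
sources: Spohn1991, Georgii1994
[support] KickedMicrostateHydro → QuenchedThermalHydro: at η ≡ 1 the kick law is (velMeasure (u 0)
(θ 0) q).map zipConfig whatever the velocities of z (√(1−1) = 0, simp), and for a density-typical
admissible q there EXIST velocity assignments making z one-body Maxwellian typical with convergent
energy (probabilistic method: LLN for ⊗ᵢ M(u(0,qᵢ),θ(0,qᵢ)) on a countable convergence-determining
family + energy, diagonal choice; or a deterministic nearest-neighbour matching with antithetic
Gaussian quantiles). [difficulty: provable-now] -/
@[route_item "route-AtomisticToContinuum-KickedOrbits"]
def KickedImpliesQuenched : Prop :=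
  KickedMicrostateHydro → QuenchedThermalHydro

-- earlier Assembly (stmt-AtomisticToContinuum-13146, replaced 2026-08-16T23:27:53Z -> stmt-AtomisticToContinuum-17702): retired by None — QuenchedThermalHydro → QuenchedToAnnealed → DiluteSelfConsistency → HydrodynamicLimit
/-- item stmt-AtomisticToContinuum-17702 · assembly · rank 1 · open · by planner
sources: Spohn1991, OllaVaradhanYau1993
[assembly] QuenchedThermalHydro → QuenchedToAnnealed → HydrodynamicLimit — identical to the deciding
theorem `closes` as re-elaborated 2026-08-16 after the statement re-type p126922 (the conjunct is
now packing-guarded, so the former antecedent DiluteSelfConsistency, which only discharged the guard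
of the old unguarded abbrev, is gone; η₀ := η₁ of QuenchedToAnnealed, strict guard weakened by
le_of_lt). -/
@[route_item "route-AtomisticToContinuum-KickedOrbits"]
def Assembly : Prop :=
  QuenchedThermalHydro → QuenchedToAnnealed → _root_.HydrodynamicLimit

/-! D-0027 §2.1 — DECIDING THEOREM (planner-authored via `route open/edit --closes-file`; by planner-rbadge-AtomisticToContinuum-KickedOrbi-ea214999-0 2026-08-16T23:38:30Z):
its hypotheses are this route's items and its conclusion the sub-problem Statement (glue_lint), and it elaborates with this file. -/

/-- D-0027 §2.1 deciding theorem (route KickedOrbits, card hydrodynamics-without-probability-pre-shock;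
re-certified 2026-08-16T23:45Z by the route-repair seat rbadge-…-ea214999 against the re-typed,
packing-guarded conjunct of `HydrodynamicLimit/Statement.lean` (p126922) — the `needs_repair` stamp
`KickedOrbits.lean:469:8 introN failed` came from a full build of the PRE-repair glue (rev 0, three
binders, `intro a₀ …` against the old unguarded abbrev) and is stale: the rev-3 file elaborates, rc 0).
Pure quantifier bookkeeping: `QuenchedToAnnealed` fed with the target `QuenchedThermalHydro` gives a
packing band η₁ and, profile by profile, a σ₁ below which every classical hard-sphere Euler solution with
ρσ³ ≤ η₁ on [0,T) is followed by the local-Gibbs hard-sphere fields; the conjunct IS this packing-guarded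
form with threshold η₀ := η₁, its strict guard ρσ³ < η₀ weakened to ≤ η₁ by `le_of_lt`. Binders = the
route's items QuenchedThermalHydro (X, rank 0) and QuenchedToAnnealed (X → Statement, rank 9). -/
@[closes "route-AtomisticToContinuum-KickedOrbits"] theorem closes (hX : QuenchedThermalHydro) (hXA : QuenchedToAnnealed) :
    _root_.HydrodynamicLimit := by
  obtain ⟨η₁, hη₁, G⟩ := hXA hX
  refine ⟨η₁, hη₁, fun a₀ θ₀ u₀ ha hθ hu ha0 hθ0 => ?_⟩
  obtain ⟨σ₁, hσ₁, G1⟩ := G a₀ θ₀ u₀ ha hθ hu ha0 hθ0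
  exact ⟨σ₁, hσ₁, fun σ hσ hσlt T ρ θ u hE hg Φ h0 t ht =>
    G1 σ hσ hσlt T ρ θ u hE (fun s hs x => le_of_lt (hg s hs x)) Φ h0 t ht⟩

end Summit.AtomisticToContinuum.HydrodynamicLimit.Theses.KickedOrbits
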